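import Summits.BirchSwinnertonDyer.Rank1Residual.Additive.KatoDescentRankOneCountContraOfFacts
import HarnessLib

set_option autoImplicit false

/-!
# PR-INV — the `ℤ_pˣ`-INDEPENDENCE of the closed Perrin-Riou ratio `Kato2004.PRRatio` of ALL its witnesses — ASSEMBLED from ONE named
# fact (`IsNewformOf.level_eq_conductorNorm`) and TWO displays: UNIT («two Tate-normalised DEFINED dual-exponential data of `(W,p)` have
# value maps proportional by a `p`-adic unit on the `p`-power levels», BK90 Prop. 3.8 / Kato LNM 1553 II §1.2) and KATO-RIGID (Kato 2004
# §13.9, p. 230 l. 4–6: «`z_γ^{(p)}` is independent of the choices … by Thm. 12.4 (2) … computing the images under (13.7.1)»)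
# (seat `bsd-cm-prr-ty1` g14, cell `bsd-cm`; theorems only: no definition, no named fact, no instance, no `sorry`)

Part 38 of the seat's kernel cut of stub 3 `stub_rankOneCountReadingKato` of the Kato–Perrin-Riou skeletons v4 (cruxes
stmt-BirchSwinnertonDyer-19945 / -19223).  After Parts 9–37 the stub (v5-recut, tame CM / all-additive rank-one rows) closes by ONE
`exact` modulo the named facts {GZK, `IsNewformOf.level_eq_conductorNorm`, `Kato2004.thm12_4`} and the displays {H2X′, PR-INV}
(`StrictCount.rankOneCountReading_tame_of_facts`, Part 37).  PR-INV is A2's hypothesis `hPRinv` (Part 11, p637083) VERBATIM: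
  `∀ W [IsElliptic] [IsGloballyMinimal] p [Fact p.Prime] (ℒ₁ ℒ₂ : ℚ_[p]), Kato2004.PRRatio W p ℒ₁ → Kato2004.PRRatio W p ℒ₂ →
   ∃ w : ℚ_[p], ‖w‖ = 1 ∧ ℒ₂ = w * ℒ₁`
— «the Perrin-Riou ratio `ℒ = log_ω(loc_p z†)·(Ω⁺_f/Ω_W)/(∏P_ℓ(ℓ⁻¹)·log_ω(P)²)` of a VALUE-PINNED Kato zeta datum of `(W,p)`
(`Kato2004/PerrinRiouRatio.lean`, (Z0)–(Z5)) does not depend on the datum, up to `ℤ_pˣ`» — the SCALE AUDIT of that file's module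
docstring, whose print content is Kato Thm. 12.4 (2) + §13.9 (independence of the choices `(α, j, c, d)`), Rohrlich, and the
Tate-duality pin (Z2) of the Néron coordinate ([BlochKato1990] Prop. 3.8; [Kato1993LNM1553] II Thm. 1.4.1).  THIS FILE reduces PR-INV
to TWO displays in the tree's own currency and ONE named fact, by `exact`:

* `hlev : ∀ N [NeZero N], IsNewformOf.level_eq_conductorNorm (N := N)` — the two witnesses' newforms have the same level, hence
  (`IsNewformOf.unique`, the `q`-expansion principle) ARE EQUAL, so their cusp factors `R_𝟙`, depletions `∏ P_ℓ(ℓ⁻¹)` and period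
  ratios `Ω⁺_f/Ω_W` (`W.realPeriodRat > 0`) are comparable;
* display **UNIT** (`hUNIT`): for two data `(ιᵢ, qᵢ, Λᵢ)` each satisfying the conjunct «(Z1) ∧ (Z2)» of `Kato2004.PRRatioBody`
  VERBATIM (`∃ d, DefinedExpStarBody W p fᵢ d ιᵢ qᵢ Λᵢ ∧` the Tate-duality normalisation of `exp*_d`), there is `e : ℚ_[p]` with
  `‖e‖ = 1` and `Λ₂ k ∅ = e • Λ₁ k ∅` on every `p`-power level — PRINT: the dual exponential is canonical ([BlochKato1990] Def. 3.10,
  [Kato1993LNM1553] II §1.2.4: `exp*_{e•d} = e⁻¹·exp*_d`) and (Z2) pins the generator `d` of `D⁰_dR` up to `ℤ_pˣ` ([BlochKato1990]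
  Prop. 3.8 and Ex. 3.11); KERNEL ROAD (next file of the seat): ℚ(ζ_{p^k}) has ONE place over `p`, so the existential
  `(w₀, g, d_{w₀})` of (DEF) of `DefinedExpStarBody` is rigid, (RES) + `FilZeroLine.exists_ne_zero_and_eq_smul` + `dualExpCoord_smul`;
* display **KATO-RIGID** (`hKR`): for ONE newform `f` of `W`, two value data `(ι₁,q₁,Λ₁)`, `(ι₂,q₂,Λ₂)` with `Λ₂ k ∅ = e • Λ₁ k ∅`
  (`e ≠ 0`), two guarded parameter sets `πᵢ = (cᵢ, dᵢ, aᵢ, Aᵢ, d′ᵢ)` (Kato's guards of Ex. 13.3 / Lemma 13.10 (1) and the value guard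
  `R_𝟙⁽ⁱ⁾ ≠ 0`), families `ZetaBody W p f ιᵢ qᵢ Λᵢ πᵢ zᵢ xᵢ`, ONE cyclotomic pin `(K, γ, I : IwasawaH1Data W p K γ)` (`γ` a topological
  generator), the Λ-adic lifts `yᵢ ∈ I.H` of the `p`-power levels (`I.proj n yᵢ = Cor(zᵢ(n+1, ∅))`, rkm's `existsUnique_lift_of_zetaBody`)
  and Kummer logarithms `tᵢ` of the bottom classes (`HasLocPKummerLog W p (layerZeroToTop (I.proj 0 yᵢ)) tᵢ`):
  `e · (q₁·R_𝟙⁽¹⁾·∏_{ℓ∣pA₁}P_ℓ(ℓ⁻¹)) · t₂ = (q₂·R_𝟙⁽²⁾·∏_{ℓ∣pA₂}P_ℓ(ℓ⁻¹)) · t₁` — PRINT: Kato 2004 §13.9 p. 230 l. 4–6 with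
  Thm. 12.4 (2) (p. 221: `𝐇¹ ⊗ ℚ` free of rank one), (13.7.1)/Prop. 13.7 (p. 227, Rohrlich), Lemma 13.10 (1) (p. 230: the cusp factor
  `(c² − cσ_c)(d² − dσ_d)`), §13.12 (p. 231: the Euler factors); KERNEL ROAD (the seat's next files): `thm12_4` ⇒ `F•y₁ = G•y₂`;
  `IwasawaH1Data.proj_smul` + (C3a) + `res ∘ Cor = Σ_Δ conj` ⇒ layer values `r_F(σ_γ − 1)·N_Δ(1 ⊗ xᵢ)`; (C5) + the tree theorems
  `PSRohrlichAtLevel.rohrlich_primePow_of_isNewformOf` (Rohrlich) and `MemIwasawaRat.finite_setOf_hasSum_zero` (Weierstrass) ⇒ an identity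
  in `Λ ⊗ ℚ_p` ⇒ its augmentation + LOG-HOM (`ContraCount.hasLocPKummerLog_smul_eq`) at the bottom layer.
MECHANISM of the assembly (`prInv_of_lev_of_unit_of_katoRigid`, §3): unfold both witnesses (`Kato2004.prRatio_iff`); `hlev` ⇒ `N₁ = N₂`,
`IsNewformOf.unique` ⇒ `f₁ = f₂`; `plusPeriod f = λᵢ·Ω_W` with `Ω_W > 0` (`realPeriod_pos'`) ⇒ `λ₁ = λ₂`; the two generators of
`W(ℚ)/tors` have `log_ω(P₁)² = log_ω(P₂)²` (§1, `sq_padicLogLocal_map_eq_of_generates`: `P₁ ≡ n•P₂`, `P₂ ≡ m•P₁` modulo torsion, so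
`(1 − nm)·log_ω P₁ = 0`); witness 2's family is RE-LIFTED into witness 1's pin `I₁` (rkm's lift exists in every pin) and its bottom
class read in `H¹(⊤, T_pW)` does not depend on the pin (§2, `layerZeroToTop_levelToLayer_zero_eq`: `K.layerSubgroup 0 = ⊤` for every
`K`); UNIT gives `e`, KATO-RIGID the displayed identity, and `ℒ₂ = e⁻¹·ℒ₁` follows by field arithmetic (`ℒᵢ = tᵢλ/(qᵢR⁽ⁱ⁾∏⁽ⁱ⁾)/log_ω(Pᵢ)²`;
when `log_ω(P) = 0` — rank `0` — both ratios are `0` by `x / 0 = 0` and `w = 1`).  So `w = e⁻¹` is EXACTLY the ratio of the two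
Néron coordinates, as the SCALE AUDIT says («`d ↦ s•d` forces … `v_p s = 0` by (Z2) (ℒ ↦ sℒ, a unit)»).
CURRENCY OF THE DISPLAYS (planner D561 (P-b)): both are typed over EXISTING tree notions only — `Kato2004.DefinedExpStarBody`
(`Kato2004/EulerSystemDefinedValues.lean`), `PAdicHodge.expStarCoord` (`PAdicHodge/DualExpElliptic.lean`), `Kato2004.padicLogLocal`,
`Kato2004.HasLocPKummerLog`, `Kato2004.layerZeroToTop` (`Kato2004/LocPKummerLog.lean`), `Kato2004.ZetaBody`, `EulerSystemValues.cycSubgroup`,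
`cycLevel`, `badPlaces`, `tateRep` (`Kato2004/EulerSystemValues.lean`), `Kato2004.IwasawaH1Data` (`Kato2004/IwasawaCohomology.lean`),
`Kato2004.levelToLayer` (`Kato2004/IwasawaCohomologyEulerSystemLift.lean`), `ratCuspFactor`, `eulerFactorAtOne`
(`Kato2004/MemberMultiplierInputs.lean`), `IsNewformOf` (`CuspFormLFunction.lean`), `ZpExtension.IsCyclotomic/IsTopGenerator`
(`ZpExtension.lean`); UNIT's antecedents are the conjunct «(Z1) ∧ (Z2)» of `Kato2004.PRRatioBody` (`Kato2004/PerrinRiouRatio.lean`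
l.178–183) VERBATIM under that definition's `letI` chain (l.154–169) — so that the unfolded witnesses feed it by `exact`; neither
display mentions `Kato2004.PRRatio` (KATO-RIGID is a statement about two Euler-system families in ONE pin, not the stub restated).
GUARDS (D440/D561): KATO-RIGID carries `p ≠ 2` (rkm's lift / Thm. 12.5 (4)), Kato's guards `A ≥ 1`, `(c, 6pA) = 1`, `(d, 6pN) = 1`
(Ex. 13.3 p. 225), `dd′ ≡ 1 (A)` (Lemma 13.10 (1) p. 230) and the value guard `R_𝟙 ≠ 0` for BOTH parameter sets, `q₁ q₂ e ≠ 0`, `f` a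
newform of `W`, `K` cyclotomic with `γ` a topological generator — every guard of `PRRatioBody`; it drops none.  Corpus: Kato p. 230 =
[corpus: paper:doi-10-24033-ast-639 p115 L8–L9] «Since 𝐇¹(V_{F_λ}(f)) is a free Λ[1/p]-module of rank 1 (Thm. 12.4 (2)), this shows that
`z_γ^{(p)}` is independent of the choices of α₁, j₁, α₂, j₂, c, d as above», [p115 L84–L85] (proof of Lemma 13.10) «By Thm. 12.4 (2), this
is obtained by computing the images of the elements in problem under the map (13.7.1) by using Thm. 6.6 and Thm. 9.7».
NON-VACUITY (D561 (P-c)): data satisfying KATO-RIGID's hypotheses are exactly what the two unfolded `PRRatio` witnesses of PR-INV supply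
(§3 feeds them by `exact`); independently, guarded parameters with `R_𝟙 ≠ 0` exist by `Kato2004.valueGuard_satisfiable`, pins by
`nonempty_iwasawaH1Data_holds`, lifts by `IwasawaH1Data.existsUnique_lift_of_zetaBody`, Kummer logarithms by Part 14's
`LocPKummer.exists_hasLocPKummerLog_of_mem_integralH1` (given a rational point of infinite order); the `ZetaBody`/`DefinedExpStarBody`
families themselves are produced in the tree only by the NAMED FACTS `exists_eulerSystem_expStar_values` /
`exists_eulerSystem_definedExpStar_values` (no `_holds`) — honest: no unconditional producer of a Kato family exists in the tree.
HONEST LABEL (D561 (P-d)): «PR-INV ⟸ {lev} + UNIT + KATO-RIGID (both displayed, not proved); after E26/E27: ⟸ {lev, KATO-RIGID};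
KATO-RIGID ⟸ thm12_4 + E28+ (not this file); registered stubs NOT closed; nothing asserted on 19945/19223»; Perrin-Riou's conjecture,
Kato's Main Conjecture, 12.4 and 12.10 are untouched; no summit statement is proved by this file; BSD is not proved for any curve.
References: [Kato2004Asterisque] Thm. 12.4 (2) (p. 221), Prop. 13.7 / (13.7.1) (p. 227), §13.9–Lemma 13.10 (pp. 229–230), §13.12
(p. 231), Ex. 13.3 (pp. 224–225); [BlochKato1990] Def. 3.10, Prop. 3.8, Ex. 3.11; [Kato1993LNM1553] Ch. II §1.2.4, Thm. 1.4.1;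
[BurnsKuriharaSano2019] Conj. 2.8 (ii) (p. 10); [PerrinRiou1993AIF] §3.3; [RohrlichInventiones1984]; [SilvermanAEC2009] IV.6.4, VII.6.3.
-/

noncomputable section

open scoped Classical NumberField BigOperators TensorProduct

open WeierstrassCurve Field IsDedekindDomain NumberField Rat.HeightOneSpectrum CongruenceSubgroup ValuativeRel
  Literature.NumberTheory.EllipticCurves Literature.NumberTheory.EllipticCurves.ModularForms
  Literature.NumberTheory.EllipticCurves.Rank1Residual Literature.NumberTheory.EllipticCurves.Rank1Residual.Typed
  Literature.NumberTheory.EllipticCurves.Kato2004 Literature.NumberTheory.EllipticCurves.IwasawaAlgebra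
  Literature.NumberTheory.EllipticCurves.Kato2004.EulerSystemValues
  Literature.NumberTheory.GaloisRepresentations Literature.NumberTheory.GaloisRepresentations.PeriodRingData
  Literature.NumberTheory.GaloisRepresentations.IsNonarchimedeanLocalField Literature.NumberTheory.PAdicHodge
  Literature.NumberTheory.AdelicBaseChange Literature.NumberTheory.Automorphic
open Summit.BirchSwinnertonDyer.BirchSwinnertonDyer.Theorems.CongruentShaFreeCutKatoKummerLogTorsion
open Summit.BirchSwinnertonDyer.Rank1Residual Summit.BirchSwinnertonDyer.Rank1Residual.Additive

namespace Summit.BirchSwinnertonDyer.Rank1Residual.Additive.PerrinRiouUnit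

/-! ## §1 Two generators of `W(ℚ)` modulo torsion have the same `log_ω²` -/

section Generators

variable (W : WeierstrassCurve ℚ) [W.IsElliptic] [W.IsGloballyMinimal] (p : ℕ) [Fact p.Prime]

/-- **`log_ω` of rational points is additive up to nothing: the map `P ↦ log_ω(P ∈ W(ℚ_p))` is a group homomorphism
`W(ℚ) →+ ℚ_p`** (`log_ω = padicLogLocal` is the tree's `ℤ_p`-linear `padicLog` on `E(ℚ_p)`, `padicLogLocal_eq_padicLog`, composed
with the additive map `W(ℚ) → W(ℚ_p)`). [cite: SilvermanAEC2009, IV.6.4 and VII.6.3] -/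
theorem exists_addMonoidHom_padicLogLocal_map :
    ∃ φ : W.toAffine.Point →+ ℚ_[p], ∀ P : W.toAffine.Point,
      φ P = padicLogLocal W p (Affine.Point.map (W' := W.toAffine) (S := ℚ) (Algebra.ofId ℚ ℚ_[p]) P) := by
  refine ⟨(Additive.LocalLog.padicLog (W.baseChange ℚ_[p])).comp
    (Affine.Point.map (W' := W.toAffine) (S := ℚ) (Algebra.ofId ℚ ℚ_[p])), fun P => ?_⟩
  rw [padicLogLocal_eq_padicLog]
  rfl

/-- **Two generators of `W(ℚ)` modulo torsion have the same `log_ω²`.**  If every point is a multiple of `P₁` up to torsion and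
also of `P₂` up to torsion, then `P₁ ≡ n•P₂`, `P₂ ≡ m•P₁`, so `(1 − nm)·log_ω(P₁) = 0` (`log_ω` is additive and kills torsion, `ℚ_p`
has characteristic `0`): either `log_ω(P₁) = 0 = log_ω(P₂)` or `nm = 1`, `n = ±1`, `log_ω(P₂) = ±log_ω(P₁)`.  (The square is the
normalisation of `Kato2004.PRRatioBody`: «`x ↦ ±x + torsion` by the square», SCALE AUDIT of `PerrinRiouRatio.lean`.)
[cite: SilvermanAEC2009, IV.6.4 and VII.6.3] [cite: BurnsKuriharaSano2019, Conj. 2.8 (ii) (p. 10)] -/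
theorem sq_padicLogLocal_map_eq_of_generates {P₁ P₂ : W.toAffine.Point}
    (h₁ : ∀ Q : W.toAffine.Point, ∃ n : ℤ, IsOfFinAddOrder (Q - n • P₁))
    (h₂ : ∀ Q : W.toAffine.Point, ∃ n : ℤ, IsOfFinAddOrder (Q - n • P₂)) :
    padicLogLocal W p (Affine.Point.map (W' := W.toAffine) (S := ℚ) (Algebra.ofId ℚ ℚ_[p]) P₁) ^ 2 =
      padicLogLocal W p (Affine.Point.map (W' := W.toAffine) (S := ℚ) (Algebra.ofId ℚ ℚ_[p]) P₂) ^ 2 := by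
  obtain ⟨φ, hφ⟩ := exists_addMonoidHom_padicLogLocal_map W p
  -- `φ` kills torsion
  have htors : ∀ Q : W.toAffine.Point, IsOfFinAddOrder Q → φ Q = 0 := by
    intro Q hQ
    obtain ⟨k, hk, hkQ⟩ := hQ.exists_nsmul_eq_zero
    have h := congrArg φ hkQ
    rw [map_nsmul, map_zero, nsmul_eq_mul, mul_eq_zero] at h
    exact h.resolve_left (Nat.cast_ne_zero.mpr hk.ne')
  obtain ⟨n, hn⟩ := h₂ P₁
  obtain ⟨m, hm⟩ := h₁ P₂
  have hn' : φ P₁ = (n : ℚ_[p]) * φ P₂ := by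
    have h := htors _ hn
    rwa [map_sub, map_zsmul, sub_eq_zero, zsmul_eq_mul] at h
  have hm' : φ P₂ = (m : ℚ_[p]) * φ P₁ := by
    have h := htors _ hm
    rwa [map_sub, map_zsmul, sub_eq_zero, zsmul_eq_mul] at h
  rw [← hφ P₁, ← hφ P₂]
  by_cases h0 : φ P₁ = 0
  · rw [hm', h0, mul_zero]
  · -- `φ P₁ = n m φ P₁` with `φ P₁ ≠ 0` forces `n m = 1`
    have hnm : (n : ℚ_[p]) * m = 1 := by
      have h : φ P₁ * ((n : ℚ_[p]) * m - 1) = 0 := by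
        have := hn'; rw [hm'] at this; linear_combination -this
      have h' := (mul_eq_zero.mp h).resolve_left h0
      linear_combination h'
    have hnmZ : n * m = 1 := by exact_mod_cast hnm
    rcases Int.eq_one_or_neg_one_of_mul_eq_one hnmZ with rfl | rfl
    · have hm1 : m = 1 := by omega
      rw [hm', hm1]; push_cast; ring
    · have hm1 : m = -1 := by omega
      rw [hm', hm1]; push_cast; ring

end Generators

/-! ## §2 The bottom class of a re-lifted family does not depend on the cyclotomic pin -/

section Pin

variable (W : WeierstrassCurve ℚ) [W.IsElliptic] (p : ℕ) [Fact p.Prime] [ContinuousSMul ℤ_[p] (W.tateModule p)]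

/-- Plumbing: `res_{⊤ → U} ∘ Cor_{L → U}` on `H¹(·, T_pW)` is the same map for any two subgroups `U₁ = U₂ = Γ_ℚ` containing `L`
(transport along `U₁ = U₂`; the finiteness structures on `Uᵢ/L` are subsingletons). [cite: NeukirchSchmidtWingberg2008, I §5 Prop. 1.5.3] -/
theorem resLe_top_coresLe_eq_of_forall_mem {U₁ U₂ L : Subgroup (absoluteGaloisGroup ℚ)}
    (h₁ : ∀ g, g ∈ U₁) (h₂ : ∀ g, g ∈ U₂) (hL₁ : L ≤ U₁) (hL₂ : L ≤ U₂) (hLo : IsOpen (L : Set (absoluteGaloisGroup ℚ)))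
    {i₁ : Fintype (U₁ ⧸ L.subgroupOf U₁)} {i₂ : Fintype (U₂ ⧸ L.subgroupOf U₂)} (ξ : H1 (tateRep W p) L) :
    resLe (tateRep W p).toTopRep (fun g _ => h₁ g : ⊤ ≤ U₁) 1 (coresLe (tateRep W p).toTopRep hL₁ hLo ξ) =
      resLe (tateRep W p).toTopRep (fun g _ => h₂ g : ⊤ ≤ U₂) 1 (coresLe (tateRep W p).toTopRep hL₂ hLo ξ) := by
  obtain rfl : U₁ = U₂ := Subgroup.ext fun g => ⟨fun _ => h₂ g, fun _ => h₁ g⟩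
  obtain rfl : i₁ = i₂ := Subsingleton.elim _ _
  rfl

/-- **The bottom class `Cor_{ℚ(μ_p)/ℚ}(z_{1,∅}) ∈ H¹(⊤, T_pW)` of an Euler-system family does not depend on the cyclotomic
`ℤ_p`-extension datum used to spell the layers**: `layerZeroToTop K₁ (levelToLayer hK₁ hp S 0 ξ) = layerZeroToTop K₂ (levelToLayer hK₂ hp S 0 ξ)`
(both are `res_{⊤ → Γ₀} Cor_{Gal(ℚ̄/ℚ(μ_p)) → Γ₀} ξ` with `Γ₀ = K.layerSubgroup 0 = Γ_ℚ`, `ZpExtension.mem_layerSubgroup_zero`).  Used to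
read witness 2's Kummer logarithm on its family RE-LIFTED into witness 1's pin. [cite: Kato2004Asterisque, §13.1 and Thm. 13.4 (pp. 224–226)] -/
theorem layerZeroToTop_levelToLayer_zero_eq {K₁ K₂ : ZpExtension ℚ p} (hK₁ : K₁.IsCyclotomic) (hK₂ : K₂.IsCyclotomic)
    (hp : p ≠ 2) (S : Set (HeightOneSpectrum (𝓞 ℚ))) (ξ : H1 (tateRep W p) ((cyclotomicLevelsRat p S).level (0 + 1) ∅)) :
    layerZeroToTop W p K₁ (levelToLayer W p hK₁ hp S 0 ξ) = layerZeroToTop W p K₂ (levelToLayer W p hK₂ hp S 0 ξ) := by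
  unfold layerZeroToTop levelToLayer
  exact resLe_top_coresLe_eq_of_forall_mem W p (ZpExtension.mem_layerSubgroup_zero K₁) (ZpExtension.mem_layerSubgroup_zero K₂)
    _ _ _ ξ

end Pin

/-! ## §3 PR-INV from `IsNewformOf.level_eq_conductorNorm` + UNIT + KATO-RIGID -/

section Assembly

set_option backward.isDefEq.respectTransparency false in
set_option maxHeartbeats 1600000 in
/-- **PR-INV — the closed Perrin-Riou ratio `Kato2004.PRRatio W p` is independent of its witness up to `ℤ_pˣ` — from the named fact
`IsNewformOf.level_eq_conductorNorm` and the displays UNIT and KATO-RIGID** (module docstring; A2's `hPRinv` VERBATIM as the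
conclusion, with `w = e⁻¹` the ratio of the two Néron coordinates).  Mechanism: unfold the two witnesses; equal levels (`hlev`) and
equal newforms (`IsNewformOf.unique`); equal period ratios (`Ω_W > 0`, `realPeriod_pos'`); equal `log_ω²` of the generators (§1); re-lift witness 2's
family into witness 1's pin (`IwasawaH1Data.existsUnique_lift_of_zetaBody`) and move its Kummer logarithm along §2; UNIT, KATO-RIGID,
field arithmetic.  Nothing else is used; Perrin-Riou's conjecture is not touched.
[cite: Kato2004Asterisque, Thm. 12.4 (2) (p. 221) and §13.9–Lemma 13.10 (pp. 229–230)] [cite: BlochKato1990, Prop. 3.8 and Ex. 3.11]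
[cite: BurnsKuriharaSano2019, Conj. 2.8 (ii) (p. 10)] -/
theorem prInv_of_lev_of_unit_of_katoRigid
    (hlev : ∀ (N : ℕ) [NeZero N], IsNewformOf.level_eq_conductorNorm (N := N))
    (hUNIT : ∀ (W : WeierstrassCurve ℚ) [W.IsElliptic] [W.IsGloballyMinimal] (p : ℕ) [Fact p.Prime],
      letI : ContinuousSMul ℤ_[p] (W.tateModule p) := TateModule.continuousSMul_padicInt
      letI : Module.Free ℤ_[p] (W.tateModule p) := W.module_free_tateModule_holds p
      letI : Module.Finite ℤ_[p] (W.tateModule p) := W.module_finite_tateModule_holds p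
      letI ρT := restrictedTateRep W (NumberField.Place.Completion (Sum.inr ((Rat.HeightOneSpectrum.primesEquiv (R := 𝓞 ℚ)).symm ⟨p, Fact.out⟩) : NumberField.Place ℚ)) p
      letI : ValuativeRel (NumberField.Place.Completion (Sum.inr ((Rat.HeightOneSpectrum.primesEquiv (R := 𝓞 ℚ)).symm ⟨p, Fact.out⟩) : NumberField.Place ℚ)) :=
        inferInstanceAs (ValuativeRel (((Rat.HeightOneSpectrum.primesEquiv (R := 𝓞 ℚ)).symm ⟨p, Fact.out⟩).adicCompletion ℚ))
      letI : TopologicalSpace (NumberField.Place.Completion (Sum.inr ((Rat.HeightOneSpectrum.primesEquiv (R := 𝓞 ℚ)).symm ⟨p, Fact.out⟩) : NumberField.Place ℚ)) :=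
        inferInstanceAs (TopologicalSpace (((Rat.HeightOneSpectrum.primesEquiv (R := 𝓞 ℚ)).symm ⟨p, Fact.out⟩).adicCompletion ℚ))
      haveI : IsNonarchimedeanLocalField (NumberField.Place.Completion (Sum.inr ((Rat.HeightOneSpectrum.primesEquiv (R := 𝓞 ℚ)).symm ⟨p, Fact.out⟩) : NumberField.Place ℚ)) :=
        inferInstanceAs (IsNonarchimedeanLocalField (((Rat.HeightOneSpectrum.primesEquiv (R := 𝓞 ℚ)).symm ⟨p, Fact.out⟩).adicCompletion ℚ))
      haveI : CharZero (NumberField.Place.Completion (Sum.inr ((Rat.HeightOneSpectrum.primesEquiv (R := 𝓞 ℚ)).symm ⟨p, Fact.out⟩) : NumberField.Place ℚ)) := LocalField.charZero_adicCompletion ((Rat.HeightOneSpectrum.primesEquiv (R := 𝓞 ℚ)).symm ⟨p, Fact.out⟩)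
      letI : Algebra ℚ_[p] (NumberField.Place.Completion (Sum.inr ((Rat.HeightOneSpectrum.primesEquiv (R := 𝓞 ℚ)).symm ⟨p, Fact.out⟩) : NumberField.Place ℚ)) :=
        LocalField.adicCompletionPadicAlgebra ((Rat.HeightOneSpectrum.primesEquiv (R := 𝓞 ℚ)).symm ⟨p, Fact.out⟩) p ((natCast_mem_asIdeal_iff_eq_primesEquiv_symm _ (Fact.out : p.Prime)).mpr rfl)
      haveI : Fact (¬ IsUnit ((p : ℕ) : integerC (NumberField.Place.Completion (Sum.inr ((Rat.HeightOneSpectrum.primesEquiv (R := 𝓞 ℚ)).symm ⟨p, Fact.out⟩) : NumberField.Place ℚ)))) :=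
        ⟨not_isUnit_natCast_integerC (show valuation (NumberField.Place.Completion (Sum.inr ((Rat.HeightOneSpectrum.primesEquiv (R := 𝓞 ℚ)).symm ⟨p, Fact.out⟩) : NumberField.Place ℚ)) ((p : ℕ) : (NumberField.Place.Completion (Sum.inr ((Rat.HeightOneSpectrum.primesEquiv (R := 𝓞 ℚ)).symm ⟨p, Fact.out⟩) : NumberField.Place ℚ))) < 1 from LocalField.valuation_adicCompletion_natCast_lt_one ((Rat.HeightOneSpectrum.primesEquiv (R := 𝓞 ℚ)).symm ⟨p, Fact.out⟩) p ((natCast_mem_asIdeal_iff_eq_primesEquiv_symm _ (Fact.out : p.Prime)).mpr rfl))⟩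
      haveI := isAdicComplete_integerC_natCast (show valuation (NumberField.Place.Completion (Sum.inr ((Rat.HeightOneSpectrum.primesEquiv (R := 𝓞 ℚ)).symm ⟨p, Fact.out⟩) : NumberField.Place ℚ)) ((p : ℕ) : (NumberField.Place.Completion (Sum.inr ((Rat.HeightOneSpectrum.primesEquiv (R := 𝓞 ℚ)).symm ⟨p, Fact.out⟩) : NumberField.Place ℚ))) < 1 from LocalField.valuation_adicCompletion_natCast_lt_one ((Rat.HeightOneSpectrum.primesEquiv (R := 𝓞 ℚ)).symm ⟨p, Fact.out⟩) p ((natCast_mem_asIdeal_iff_eq_primesEquiv_symm _ (Fact.out : p.Prime)).mpr rfl))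
      -- the tree's `ℚ`-algebra structure on `ℚ_v` (the one W2's restricted representations are built on) is pinned
      -- as the most recent local instance, so that it — and not `DivisionRing.toRatAlgebra` — is synthesized below
      letI : Algebra ℚ (NumberField.Place.Completion (Sum.inr ((Rat.HeightOneSpectrum.primesEquiv (R := 𝓞 ℚ)).symm ⟨p, Fact.out⟩) : NumberField.Place ℚ)) := NumberField.Place.instAlgebraCompletion (Sum.inr ((Rat.HeightOneSpectrum.primesEquiv (R := 𝓞 ℚ)).symm ⟨p, Fact.out⟩) : NumberField.Place ℚ)
      ∀ {N₁ : ℕ} [NeZero N₁] (f₁ : CuspForm (Gamma0 N₁) 2) {N₂ : ℕ} [NeZero N₂] (f₂ : CuspForm (Gamma0 N₂) 2)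
        (ι₁ ι₂ : (n : ℕ) → (CyclotomicField n ℚ →+* ℂ)) (q₁ q₂ : ℚ)
        (Λ₁ Λ₂ : ∀ (k : ℕ) (r : Finset (HeightOneSpectrum (𝓞 ℚ))),
          H1 (tateRep W p) (cycSubgroup p k r) →ₗ[ℤ_[p]] ℚ_[p] ⊗[ℚ] CyclotomicField (cycLevel p k r) ℚ),
      (∃ d, DefinedExpStarBody W p f₁ d ι₁ ((q₁ : ℚ) : ℝ) Λ₁ ∧
        ∀ a : (NumberField.Place.Completion (Sum.inr ((Rat.HeightOneSpectrum.primesEquiv (R := 𝓞 ℚ)).symm ⟨p, Fact.out⟩) : NumberField.Place ℚ)),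
          (∃ η : contOneCocycles ρT.toTopRep, expStarCoord W (show valuation (NumberField.Place.Completion (Sum.inr ((Rat.HeightOneSpectrum.primesEquiv (R := 𝓞 ℚ)).symm ⟨p, Fact.out⟩) : NumberField.Place ℚ)) ((p : ℕ) : (NumberField.Place.Completion (Sum.inr ((Rat.HeightOneSpectrum.primesEquiv (R := 𝓞 ℚ)).symm ⟨p, Fact.out⟩) : NumberField.Place ℚ))) < 1 from LocalField.valuation_adicCompletion_natCast_lt_one ((Rat.HeightOneSpectrum.primesEquiv (R := 𝓞 ℚ)).symm ⟨p, Fact.out⟩) p ((natCast_mem_asIdeal_iff_eq_primesEquiv_symm _ (Fact.out : p.Prime)).mpr rfl)) d η = a) ↔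
            ∀ Q : (W.baseChange ℚ_[p]).toAffine.Point,
              ‖(Padic.adicCompletionEquiv (𝓞 ℚ) ⟨p, Fact.out⟩).symm
                  (show ((Rat.HeightOneSpectrum.primesEquiv (R := 𝓞 ℚ)).symm ⟨p, Fact.out⟩).adicCompletion ℚ from a) * padicLogLocal W p Q‖ ≤ 1) →
      (∃ d, DefinedExpStarBody W p f₂ d ι₂ ((q₂ : ℚ) : ℝ) Λ₂ ∧
        ∀ a : (NumberField.Place.Completion (Sum.inr ((Rat.HeightOneSpectrum.primesEquiv (R := 𝓞 ℚ)).symm ⟨p, Fact.out⟩) : NumberField.Place ℚ)),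
          (∃ η : contOneCocycles ρT.toTopRep, expStarCoord W (show valuation (NumberField.Place.Completion (Sum.inr ((Rat.HeightOneSpectrum.primesEquiv (R := 𝓞 ℚ)).symm ⟨p, Fact.out⟩) : NumberField.Place ℚ)) ((p : ℕ) : (NumberField.Place.Completion (Sum.inr ((Rat.HeightOneSpectrum.primesEquiv (R := 𝓞 ℚ)).symm ⟨p, Fact.out⟩) : NumberField.Place ℚ))) < 1 from LocalField.valuation_adicCompletion_natCast_lt_one ((Rat.HeightOneSpectrum.primesEquiv (R := 𝓞 ℚ)).symm ⟨p, Fact.out⟩) p ((natCast_mem_asIdeal_iff_eq_primesEquiv_symm _ (Fact.out : p.Prime)).mpr rfl)) d η = a) ↔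
            ∀ Q : (W.baseChange ℚ_[p]).toAffine.Point,
              ‖(Padic.adicCompletionEquiv (𝓞 ℚ) ⟨p, Fact.out⟩).symm
                  (show ((Rat.HeightOneSpectrum.primesEquiv (R := 𝓞 ℚ)).symm ⟨p, Fact.out⟩).adicCompletion ℚ from a) * padicLogLocal W p Q‖ ≤ 1) →
      ∃ e : ℚ_[p], ‖e‖ = 1 ∧ ∀ (k : ℕ) (y : H1 (tateRep W p) (cycSubgroup p k ∅)), Λ₂ k ∅ y = e • Λ₁ k ∅ y)
    (hKR : ∀ (W : WeierstrassCurve ℚ) [W.IsElliptic] [W.IsGloballyMinimal] (p : ℕ) [Fact p.Prime],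
      letI : ContinuousSMul ℤ_[p] (W.tateModule p) := TateModule.continuousSMul_padicInt
      letI : Module.Free ℤ_[p] (W.tateModule p) := W.module_free_tateModule_holds p
      letI : Module.Finite ℤ_[p] (W.tateModule p) := W.module_finite_tateModule_holds p
      ∀ (hp : p ≠ 2) {N : ℕ} [NeZero N] (f : CuspForm (Gamma0 N) 2), IsNewformOf W f →
      ∀ (ι₁ ι₂ : (n : ℕ) → (CyclotomicField n ℚ →+* ℂ)) (q₁ q₂ : ℚ)
        (Λ₁ Λ₂ : ∀ (k : ℕ) (r : Finset (HeightOneSpectrum (𝓞 ℚ))),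
          H1 (tateRep W p) (cycSubgroup p k r) →ₗ[ℤ_[p]] ℚ_[p] ⊗[ℚ] CyclotomicField (cycLevel p k r) ℚ) (e : ℚ_[p]),
        q₁ ≠ 0 → q₂ ≠ 0 → e ≠ 0 → (∀ (k : ℕ) (y : H1 (tateRep W p) (cycSubgroup p k ∅)), Λ₂ k ∅ y = e • Λ₁ k ∅ y) →
      ∀ (c₁ d₁ a₁ : ℤ) (A₁ : ℕ) (d'₁ : ℤ) (c₂ d₂ a₂ : ℤ) (A₂ : ℕ) (d'₂ : ℤ),
        0 < A₁ → Int.gcd c₁ (6 * p * A₁) = 1 → Int.gcd d₁ (6 * p * N) = 1 → (d₁ : ℤ) * d'₁ ≡ 1 [ZMOD (A₁ : ℤ)] →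
        ratCuspFactor f true c₁ d₁ a₁ A₁ d'₁ ≠ 0 →
        0 < A₂ → Int.gcd c₂ (6 * p * A₂) = 1 → Int.gcd d₂ (6 * p * N) = 1 → (d₂ : ℤ) * d'₂ ≡ 1 [ZMOD (A₂ : ℤ)] →
        ratCuspFactor f true c₂ d₂ a₂ A₂ d'₂ ≠ 0 →
      ∀ (z₁ : ∀ (k : ℕ) (r : (cyclotomicLevelsRat p (badPlaces c₁ d₁ A₁ N)).Ideals),
          H1 (tateRep W p) ((cyclotomicLevelsRat p (badPlaces c₁ d₁ A₁ N)).level k r.1))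
        (x₁ : ∀ (k : ℕ) (r : (cyclotomicLevelsRat p (badPlaces c₁ d₁ A₁ N)).Ideals), CyclotomicField (cycLevel p k r.1) ℚ),
        ZetaBody W p f ι₁ ((q₁ : ℚ) : ℝ) Λ₁ c₁ d₁ a₁ A₁ z₁ x₁ →
      ∀ (z₂ : ∀ (k : ℕ) (r : (cyclotomicLevelsRat p (badPlaces c₂ d₂ A₂ N)).Ideals),
          H1 (tateRep W p) ((cyclotomicLevelsRat p (badPlaces c₂ d₂ A₂ N)).level k r.1))
        (x₂ : ∀ (k : ℕ) (r : (cyclotomicLevelsRat p (badPlaces c₂ d₂ A₂ N)).Ideals), CyclotomicField (cycLevel p k r.1) ℚ),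
        ZetaBody W p f ι₂ ((q₂ : ℚ) : ℝ) Λ₂ c₂ d₂ a₂ A₂ z₂ x₂ →
      ∀ (K : ZpExtension ℚ p) (hK : K.IsCyclotomic) (γ : absoluteGaloisGroup ℚ), K.IsTopGenerator γ →
      ∀ (I : IwasawaH1Data W p K γ) (y₁ y₂ : I.H),
        (∀ n : ℕ, I.proj n y₁ = levelToLayer W p hK hp (badPlaces c₁ d₁ A₁ N) n
          (z₁ (n + 1) (cyclotomicLevelsRat p (badPlaces c₁ d₁ A₁ N)).idealOne)) →
        (∀ n : ℕ, I.proj n y₂ = levelToLayer W p hK hp (badPlaces c₂ d₂ A₂ N) n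
          (z₂ (n + 1) (cyclotomicLevelsRat p (badPlaces c₂ d₂ A₂ N)).idealOne)) →
      ∀ (t₁ t₂ : ℚ_[p]), HasLocPKummerLog W p (layerZeroToTop W p K (I.proj 0 y₁)) t₁ →
        HasLocPKummerLog W p (layerZeroToTop W p K (I.proj 0 y₂)) t₂ →
        e * ((q₁ * ratCuspFactor f true c₁ d₁ a₁ A₁ d'₁ * ∏ ℓ ∈ (p * A₁).primeFactors, eulerFactorAtOne W N ℓ : ℚ) : ℚ_[p]) * t₂ =
          ((q₂ * ratCuspFactor f true c₂ d₂ a₂ A₂ d'₂ * ∏ ℓ ∈ (p * A₂).primeFactors, eulerFactorAtOne W N ℓ : ℚ) : ℚ_[p]) * t₁) :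
    ∀ (W : WeierstrassCurve ℚ) [W.IsElliptic] [W.IsGloballyMinimal] (p : ℕ) [Fact p.Prime]
      (ℒ₁ ℒ₂ : ℚ_[p]), Kato2004.PRRatio W p ℒ₁ → Kato2004.PRRatio W p ℒ₂ → ∃ w : ℚ_[p], ‖w‖ = 1 ∧ ℒ₂ = w * ℒ₁ := by
  intro W _ _ p _ ℒ₁ ℒ₂ hℒ₁ hℒ₂
  letI instC : ContinuousSMul ℤ_[p] (W.tateModule p) := TateModule.continuousSMul_padicInt
  letI instF : Module.Free ℤ_[p] (W.tateModule p) := W.module_free_tateModule_holds p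
  letI instFi : Module.Finite ℤ_[p] (W.tateModule p) := W.module_finite_tateModule_holds p
  -- the two witnesses, unfolded
  obtain ⟨hp₁, N₁, hN₁, f₁, hf₁, ι₁, q₁, Λ₁, hq₁, hZ₁, c₁, d₁, a₁, A₁, d'₁, hA₁, hc₁, hd₁, hdd₁, hR₁, z₁, x₁, hzeta₁,
    K₁, hK₁, γ₁, hγ₁, I₁, y₁, hy₁, t₁, P₁, lam₁, ht₁, hP₁, hlam₁, hℒ₁eq⟩ := (Kato2004.prRatio_iff W p ℒ₁).mp hℒ₁
  obtain ⟨hp₂, N₂, hN₂, f₂, hf₂, ι₂, q₂, Λ₂, hq₂, hZ₂, c₂, d₂, a₂, A₂, d'₂, hA₂, hc₂, hd₂, hdd₂, hR₂, z₂, x₂, hzeta₂,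
    K₂, hK₂, γ₂, hγ₂, I₂, y₂, hy₂, t₂, P₂, lam₂, ht₂, hP₂, hlam₂, hℒ₂eq⟩ := (Kato2004.prRatio_iff W p ℒ₂).mp hℒ₂
  haveI : NeZero N₁ := hN₁
  haveI : NeZero N₂ := hN₂
  -- equal levels, equal newforms
  obtain rfl : N₁ = N₂ := (hlev N₁ hf₁).trans (hlev N₂ hf₂).symm
  obtain rfl : f₁ = f₂ := hf₁.unique hf₂
  -- equal period ratios
  have hlam : lam₁ = lam₂ := by
    have hΩ : (W.realPeriodRat : ℝ) ≠ 0 := by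
      -- `Ω_W > 0`: the tree's `realPeriod_pos'` on `W ⊗ ℝ` (= `realPeriodRat_pos_holds` / `KatoCurve.realPeriodRat_pos`, inlined)
      haveI : (W.baseChange ℝ).IsElliptic := by rw [baseChange]; infer_instance
      rw [WeierstrassCurve.realPeriodRat_def]
      exact (W.baseChange ℝ).realPeriod_pos'.ne'
    have h : ((lam₁ : ℚ) : ℝ) * W.realPeriodRat = ((lam₂ : ℚ) : ℝ) * W.realPeriodRat := by rw [← hlam₁, ← hlam₂]
    exact_mod_cast mul_right_cancel₀ hΩ h
  -- equal `log_ω²` of the generators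
  have hG := sq_padicLogLocal_map_eq_of_generates W p hP₁ hP₂
  -- UNIT
  obtain ⟨e, he1, hΛ⟩ := hUNIT W p f₁ f₁ ι₁ ι₂ q₁ q₂ Λ₁ Λ₂ hZ₁ hZ₂
  have he0 : e ≠ 0 := fun h => by rw [h, norm_zero] at he1; exact zero_ne_one he1
  -- re-lift witness 2's family into witness 1's pin and move its Kummer logarithm
  obtain ⟨y₂', hy₂', -⟩ :=
    IwasawaH1Data.existsUnique_lift_of_zetaBody p W hK₁ hp₁ I₁ f₁ _ ((q₂ : ℚ) : ℝ) Λ₂ c₂ d₂ a₂ A₂ z₂ x₂ hzeta₂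
  have ht₂' : HasLocPKummerLog W p (layerZeroToTop W p K₁ (I₁.proj 0 y₂')) t₂ := by
    rw [hy₂' 0, layerZeroToTop_levelToLayer_zero_eq W p hK₁ hK₂ hp₁ (badPlaces c₂ d₂ A₂ N₁), ← hy₂ 0]
    exact ht₂
  -- KATO-RIGID
  have hkr := hKR W p hp₁ f₁ hf₁ ι₁ ι₂ q₁ q₂ Λ₁ Λ₂ e hq₁ hq₂ he0 hΛ c₁ d₁ a₁ A₁ d'₁ c₂ d₂ a₂ A₂ d'₂ hA₁ hc₁ hd₁ hdd₁ hR₁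
    hA₂ hc₂ hd₂ hdd₂ hR₂ z₁ x₁ hzeta₁ z₂ x₂ hzeta₂ K₁ hK₁ γ₁ hγ₁ I₁ y₁ y₂' hy₁ hy₂' t₁ t₂ ht₁ ht₂'
  -- the constants are non-zero
  set M₁ : ℚ := q₁ * ratCuspFactor f₁ true c₁ d₁ a₁ A₁ d'₁ * ∏ ℓ ∈ (p * A₁).primeFactors, eulerFactorAtOne W N₁ ℓ with hM₁
  set M₂ : ℚ := q₂ * ratCuspFactor f₁ true c₂ d₂ a₂ A₂ d'₂ * ∏ ℓ ∈ (p * A₂).primeFactors, eulerFactorAtOne W N₁ ℓ with hM₂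
  have hE₁ : ∀ ℓ ∈ (p * A₁).primeFactors, eulerFactorAtOne W N₁ ℓ ≠ 0 := fun ℓ hℓ =>
    eulerFactorAtOne_ne_zero W hf₁ (Nat.prime_of_mem_primeFactors hℓ)
  have hE₂ : ∀ ℓ ∈ (p * A₂).primeFactors, eulerFactorAtOne W N₁ ℓ ≠ 0 := fun ℓ hℓ =>
    eulerFactorAtOne_ne_zero W hf₁ (Nat.prime_of_mem_primeFactors hℓ)
  have hM₁0 : ((M₁ : ℚ) : ℚ_[p]) ≠ 0 := by
    have : M₁ ≠ 0 := mul_ne_zero (mul_ne_zero hq₁ hR₁) (Finset.prod_ne_zero_iff.mpr hE₁)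
    exact_mod_cast this
  have hM₂0 : ((M₂ : ℚ) : ℚ_[p]) ≠ 0 := by
    have : M₂ ≠ 0 := mul_ne_zero (mul_ne_zero hq₂ hR₂) (Finset.prod_ne_zero_iff.mpr hE₂)
    exact_mod_cast this
  set G₁ : ℚ_[p] := padicLogLocal W p (Affine.Point.map (W' := W.toAffine) (S := ℚ) (Algebra.ofId ℚ ℚ_[p]) P₁) with hG₁
  set G₂ : ℚ_[p] := padicLogLocal W p (Affine.Point.map (W' := W.toAffine) (S := ℚ) (Algebra.ofId ℚ ℚ_[p]) P₂) with hG₂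
  by_cases hG0 : G₁ = 0
  · -- rank `0`: both ratios vanish (`x / 0 = 0`)
    refine ⟨1, norm_one, ?_⟩
    have hG₂0 : G₂ ^ 2 = 0 := by rw [← hG, hG0]; ring
    rw [hℒ₂eq, hℒ₁eq, hG0, hG₂0]
    simp
  · refine ⟨e⁻¹, by rw [norm_inv, he1, inv_one], ?_⟩
    have hG2 : G₁ ^ 2 ≠ 0 := pow_ne_zero 2 hG0
    rw [hℒ₂eq, hℒ₁eq, ← hlam, ← hG]
    field_simp
    linear_combination (((lam₁ : ℚ) : ℚ_[p])) * hkr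

end Assembly

end Summit.BirchSwinnertonDyer.Rank1Residual.Additive.PerrinRiouUnit

end
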